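import Literature.Topology.FourManifolds.TrisectionsSectorTwoHandles
import Literature.Topology.FourManifolds.TrisectionsHeegaardGlobal
import Literature.Topology.FourManifolds.TrisectionsExistence
import Literature.Topology.FourManifolds.GradientLikeExistence
import Literature.Topology.FourManifolds.MilnorChartIndex
import Literature.Topology.FourManifolds.MilnorBoxDynamics
import HarnessLib

/-!
# Setting up the Morse-theoretic trisection, I: the Morse function, the gradient-like field and
# the `2`-handle boxes

Topic `Literature/Topology/FourManifolds`; step H (part b-1) of a Morse-theoretic construction of
Gay–Kirby's trisection for the fact seat
`provefact-Literature.Topology.FourManifolds.exists_isBalancedGKTrisection` (Gay–Kirby 2016,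
Thm. 4 via §4, Lemma 14).  Everything in this file is **proved**; the definitions are a data
structure and the tube system read off it.

On a closed connected smooth `4`-manifold `X` we fix (`exists_setupBoxes`):

* a self-indexing Morse function `f` with one minimum, one maximum and as many critical points of
  index `1` as of index `3` (`exists_isSelfIndexing_balanced`, Gay–Kirby's balanced handle
  decomposition, proof of Thm. 4: Milnor 1965, Thms. 4.8, 8.1 and Lemma 8.2);
* a smooth gradient-like field `ζ` for `f` (Milnor 1965, Lemma 3.2: `IsMorse.exists_isGradientLike`);
* Milnor boxes of `(f, ζ)` about the critical points of index `2` (the critical level `2`), with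
  pairwise disjoint chart domains (`IsGradientLike.exists_milnorBox_source_subset` inside
  disjoint open neighbourhoods, `Set.Finite.t2_separation`), of index `k = 2`
  (`isMCriticalPt_and_morseIndex_eq_of_eq_milnorQuadratic`), a common radius `R` of the charts,
  and a scale `0 < η ≤ min(R²/25, 1/8)`: the level of the construction is `a = 2 - η`, the band
  `[a - η, a + 2η) = [2 - 2η, 2 + η)` contains no critical value but `2`
  (`HandleBoxes f ζ (2 - η) η ι`, `TrisectionsHandleBoxes.lean`);
* the tube system of the boxes (`SetupBoxes.tubeSystem`, `TrisectionsHeegaardGlobal.lean`), whose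
  centred coordinates are the box coordinates (`coord_eq_centred`).

## References

* D. Gay, R. Kirby, *Trisecting 4-manifolds*, Geom. Topol. 20 (2016), §4, proof of Thm. 4 and Lemma 14. [GayKirby2016]
* J. Milnor, *Lectures on the h-cobordism theorem* (1965), Def. 3.1, Lemma 3.2, Thm. 4.8, Thm. 8.1, Lemma 8.2. [MilnorHCobordism1965]
-/

open scoped Manifold ContDiff Topology
open Set Function Filter Metric

noncomputable section

universe u

namespace Literature.Topology.FourManifolds

/-- Local notation: `𝔼 n` is the model Euclidean space `EuclideanSpace ℝ (Fin n)`. -/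
local notation "𝔼 " n:arg => EuclideanSpace ℝ (Fin n)

variable (X : Type u) [TopologicalSpace X] [ChartedSpace (𝔼 4) X] [IsManifold (𝓡 4) ∞ X]

/-- **The Morse function, the gradient-like field, the scale and the `2`-handle boxes** of the
construction. [cite: GayKirby2016, §4, proof of Thm. 4] [cite: MilnorHCobordism1965, Def. 3.1, Lemma 3.2] -/
structure SetupBoxes where
  /-- The Morse function. -/
  f : X → ℝ
  /-- It is Morse. -/
  hfM : IsMorse (𝓡 4) f
  /-- It is self-indexing. -/
  hsi : IsSelfIndexing (𝓡 4) f
  /-- One minimum. -/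
  hc0 : (criticalSetOfIndex (𝓡 4) f 0).ncard = 1
  /-- One maximum. -/
  hc4 : (criticalSetOfIndex (𝓡 4) f 4).ncard = 1
  /-- Balanced ends: `#Crit₁ = #Crit₃`. -/
  hbal : (criticalSetOfIndex (𝓡 4) f 1).ncard = (criticalSetOfIndex (𝓡 4) f 3).ncard
  /-- The gradient-like field. -/
  ζ : Π x : X, TangentSpace (𝓡 4) x
  /-- It is smooth. -/
  hζ : ContMDiff (𝓡 4) (𝓡 4).tangent ∞ fun x => (⟨x, ζ x⟩ : TangentBundle (𝓡 4) X)
  /-- It is gradient-like. -/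
  hgl : IsGradientLike (𝓡 4) f ζ
  /-- The index type of the `2`-handles. -/
  ι : Type
  /-- It is finite. -/
  instFintype : Fintype ι
  /-- The scale. -/
  η : ℝ
  /-- The common chart radius. -/
  R : ℝ
  /-- `R > 0`. -/
  hR : 0 < R
  /-- `η ≤ R²/25`. -/
  hηR : η ≤ R ^ 2 / 25
  /-- `η ≤ 1/8`. -/
  hη8 : η ≤ 1 / 8
  /-- The `2`-handle boxes over the level `a = 2 - η`. -/
  H : HandleBoxes f ζ (2 - η) η ι
  /-- The charts contain the closed ball of radius `R` about the centre. -/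
  closedBall_subset : ∀ j, closedBall ((H.box j).chart (H.cpt j)) R ⊆ (H.box j).chart.target
  /-- The centres have index `2`. -/
  hcpt_idx : ∀ j, morseIndex (𝓡 4) f (H.cpt j) = 2

namespace SetupBoxes

variable {X} (P : SetupBoxes X)

/-- The index type is finite. [folklore] -/
instance : Fintype P.ι := P.instFintype

/-- The level of the construction, `a = 2 - η`. [cite: GayKirby2016, §4, Lemma 14] -/
def a : ℝ := 2 - P.η

/-- Unfolding of `a`. [folklore] -/
theorem a_def : P.a = 2 - P.η := rfl

/-- `η > 0`. [folklore] -/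
theorem eta_pos : 0 < P.η := P.H.eta_pos

/-- `4η ≤ R²`. [folklore] -/
theorem four_eta_le : 4 * P.η ≤ P.R ^ 2 := by have := P.hηR; nlinarith [sq_nonneg P.R]

/-- **The tube system of the boxes** (same charts and centres, common radius `R`). [cite: GayKirby2016, §4, Lemma 14] -/
def tubeSystem : TubeSystem P.f P.a P.η P.ι where
  chart j := (P.H.box j).chart
  centre := P.H.cpt
  mem_maximalAtlas j := (P.H.box j).mem_maximalAtlas
  mem_source j := (P.H.box j).mem_source
  apply_centre j := P.H.apply_cpt j
  apply_eq j q hq := by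
    have h := (P.H.box j).apply_eq q hq
    rw [MilnorBox.extend_coe_eq, P.H.k_eq j] at h
    exact h
  disjoint := P.H.disjoint
  R := P.R
  R_pos := P.hR
  closedBall_subset := P.closedBall_subset
  eta_pos := P.eta_pos
  eta_le := P.four_eta_le

/-- The charts of the tube system are the box charts. [folklore] -/
@[simp] theorem tubeSystem_chart (j : P.ι) : P.tubeSystem.chart j = (P.H.box j).chart := rfl

/-- The centres of the tube system are the box centres. [folklore] -/
@[simp] theorem tubeSystem_centre (j : P.ι) : P.tubeSystem.centre j = P.H.cpt j := rfl

/-- The radius of the tube system is `R`. [folklore] -/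
@[simp] theorem tubeSystem_R : P.tubeSystem.R = P.R := rfl

/-- **The box coordinates are the centred tube coordinates.** [folklore] -/
theorem coord_eq_centred (j : P.ι) (q : X) : (P.H.box j).coord q = P.tubeSystem.centred j q := by
  rw [MilnorBox.coord_eq, TubeSystem.centred_apply, tubeSystem_chart, tubeSystem_centre]

/-- The critical values in the band are on the level `2`: a critical point of `f` with
`f ∈ [2 - 2η, 2 + η)` is a box centre. [folklore] -/
theorem crit_val {q : X} (hc : IsMCriticalPt (𝓡 4) P.f q) (h₁ : P.a - P.η ≤ P.f q) (h₂ : P.f q < P.a + 2 * P.η) :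
    ∃ j, q = P.H.cpt j := P.H.crit_val q hc h₁ h₂

end SetupBoxes

/-! ### Existence -/

variable [T2Space X] [SecondCountableTopology X] [CompactSpace X] [ConnectedSpace X]

/-- `min m k = 2` with `m = 4` forces `k = 2`. [folklore] -/
theorem eq_two_of_min_four_eq {k : ℕ} (h : min 4 k = 2) : k = 2 := by omega

/-- **Existence of the set-up boxes** on a closed connected smooth `4`-manifold. [cite: GayKirby2016, §4, proof of Thm. 4] [cite: MilnorHCobordism1965, Def. 3.1, Lemma 3.2] -/
theorem exists_setupBoxes : Nonempty (SetupBoxes X) := by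
  classical
  -- the balanced self-indexing Morse function
  obtain ⟨f, hfM, hsi, hc0, hc4, hbal⟩ := exists_isSelfIndexing_balanced X
  -- a smooth gradient-like field
  obtain ⟨ξs, hgl⟩ := hfM.exists_isGradientLike fun p _ => BoundarylessManifold.isInteriorPoint
  set ζ : Π x : X, TangentSpace (𝓡 4) x := fun x => ξs x with hζdef
  have hζ : ContMDiff (𝓡 4) (𝓡 4).tangent ∞ fun x => (⟨x, ζ x⟩ : TangentBundle (𝓡 4) X) := ξs.contMDiff
  have hglζ : IsGradientLike (𝓡 4) f ζ := hgl
  -- the critical points of index `2`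
  set C₂ : Set X := criticalSetOfIndex (𝓡 4) f 2 with hC₂
  have hfin : C₂.Finite := (IsMorse.finite_criticalSet_holds hfM).subset (criticalSetOfIndex_subset _ f 2)
  haveI : Fintype C₂ := hfin.fintype
  set n : ℕ := Fintype.card C₂ with hn
  let e : C₂ ≃ Fin n := Fintype.equivFin C₂
  -- disjoint open neighbourhoods and boxes inside them
  obtain ⟨U, hU, hdisj⟩ := hfin.t2_separation
  have hbox : ∀ c : C₂, ∃ D : MilnorBox (𝓡 4) f ζ c.1, D.chart.source ⊆ U c.1 := fun c =>
    hglζ.exists_milnorBox_source_subset c.2.1 BoundarylessManifold.isInteriorPoint (hU c.1).2 (hU c.1).1 fun _ _ => rfl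
  choose D hD using hbox
  -- the index of the boxes
  have hk : ∀ c : C₂, (D c).k = 2 := by
    intro c
    have h := (isMCriticalPt_and_morseIndex_eq_of_eq_milnorQuadratic ((hfM.contMDiff.of_le (by norm_cast)) c.1)
      (D c).mem_maximalAtlas (D c).mem_source BoundarylessManifold.isInteriorPoint (D c).apply_eq).2
    rw [c.2.2] at h
    exact eq_two_of_min_four_eq h.symm
  -- the common radius
  have hRex : ∃ R : ℝ, 0 < R ∧ ∀ c : C₂, R ≤ (D c).ε := by
    by_cases hne : Nonempty C₂
    · refine ⟨Finset.univ.inf' Finset.univ_nonempty fun c => (D c).ε, ?_, fun c => Finset.inf'_le _ (Finset.mem_univ c)⟩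
      obtain ⟨c₀, -, hc₀⟩ := Finset.exists_mem_eq_inf' Finset.univ_nonempty fun c : C₂ => (D c).ε
      rw [hc₀]; exact (D c₀).eps_pos
    · exact ⟨1, one_pos, fun c => absurd ⟨c⟩ hne⟩
  obtain ⟨R, hR, hRε⟩ := hRex
  -- the scale
  set η : ℝ := min (R ^ 2 / 25) (1 / 8) with hηdef
  have hηR : η ≤ R ^ 2 / 25 := min_le_left _ _
  have hη8 : η ≤ 1 / 8 := min_le_right _ _
  have hηpos : 0 < η := lt_min (by positivity) (by norm_num)
  -- the handle boxes, indexed by `Fin n`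
  have hval : ∀ c : C₂, f c.1 = (2 - η) + η := fun c => by
    rw [hsi c.1 c.2.1, c.2.2]; push_cast; ring
  let H : HandleBoxes f ζ (2 - η) η (Fin n) :=
    { cpt := fun i => (e.symm i).1
      box := fun i => D (e.symm i)
      k_eq := fun i => hk (e.symm i)
      apply_cpt := fun i => hval (e.symm i)
      disjoint := fun i j hij =>
        Set.disjoint_of_subset (hD (e.symm i)) (hD (e.symm j))
          (hdisj (e.symm i).2 (e.symm j).2 fun h => hij (e.symm.injective (Subtype.ext h)))
      eta_pos := hηpos
      eta_lt := fun i => by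
        have h1 : R ^ 2 ≤ (D (e.symm i)).ε ^ 2 := by
          have := hRε (e.symm i); have := hR; nlinarith
        nlinarith
      crit_val := fun q hq h₁ h₂ => by
        have hfq : f q = morseIndex (𝓡 4) f q := hsi q hq
        set i := morseIndex (𝓡 4) f q with hi
        have hlo : (1 : ℝ) < i := by rw [← hfq]; linarith
        have hhi : (i : ℝ) < 3 := by rw [← hfq]; linarith
        have hi2 : i = 2 := by
          have h1 : 1 < i := by exact_mod_cast hlo
          have h2 : i < 3 := by exact_mod_cast hhi
          omega
        exact ⟨e ⟨q, hq, hi2⟩, by simp⟩ }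
  refine ⟨⟨f, hfM, hsi, hc0, hc4, hbal, ζ, hζ, hglζ, Fin n, inferInstance, η, R, hR, hηR, hη8, H, fun i => ?_,
    fun i => (e.symm i).2.2⟩⟩
  -- the closed ball of radius `R` about the centre lies in the chart target
  have h3 := (D (e.symm i)).closedBall_subset
  rw [MilnorBox.extend_coe_eq] at h3
  have htgt : ((D (e.symm i)).chart.extend (𝓡 4)).target = (D (e.symm i)).chart.target := by
    rw [OpenPartialHomeomorph.extend_target]
    ext u
    simp
  rw [htgt] at h3
  refine Subset.trans (closedBall_subset_closedBall ?_) h3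
  linarith [hRε (e.symm i), (D (e.symm i)).eps_pos]

end Literature.Topology.FourManifolds

end
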